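import Mathlib
import HarnessLib
import Summits.Langlands.Langlands.Theses.QuarterDeficit1951
import Literature.NumberTheory.Automorphic.GL2RSLFactorCharacter
import Literature.NumberTheory.Automorphic.GL2SphericalOfLFactorDegreeTwo
import Literature.NumberTheory.Automorphic.TateLocalFactors
import Literature.NumberTheory.Automorphic.LocalFieldHaarBalls
import Summits.Langlands.Langlands.Theorems.QuarterDeficit1951CorrespondentFingerprintStubLocal1951RepTheoryAux1
import Summits.Langlands.Langlands.Theorems.QuarterDeficit1951CorrespondentFingerprintStubLocal1951RepTheoryAux2

/-!
# (C3) `stub_local1951_reptheory`: a `K₁(𝔭)`-fixed vector from two `L`-degrees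
(crux stmt-Langlands-15898 `QuarterDeficit1951.CorrespondentFingerprint`, line `Sketch`, registered
stub `stub_local1951_reptheory`, sub-goal C3 of `stub_levelOne_local1951`)

Let `F` be a non-archimedean local field, `π` an irreducible smooth representation of `GL₂(F)`,
`ψ ≠ 1` continuous, `χ : Fˣ → ℂˣ` trivial on `U¹ = 1 + 𝔭` and non-trivial on `𝒪ˣ`.  **Theorem**
(`stub_local1951_reptheory`; Casselman 1973, Thm. 1 at conductor exponent one, proved here
without the classification, extending the tree's `GL2SphericalOfLFactorDegreeTwo`): if for every
invariant Radon full-support `ν` on `GL₁(F) ⧸ U₁` the JPSS polynomials of `π × 1` and of `π × χ⁻¹`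
have degree `≥ 1`, then `π` has a non-zero vector fixed by
`K₁(𝔭) = {k ∈ GL₂(𝒪) : |k₂₁| < 1, |k₂₂ - 1| < 1}`.

## Proof

* (Aux2) the pole bound `deg P ≤ dim M` (`natDegree_le_finrank_of_hasRSLFactor`) gives a non-zero
  `d(𝒪ˣ,1)`-FIXED class `x₁ ∈ V_N`, and — through `L(π × χ⁻¹) = L((π ⊗ χ⁻¹∘det) × 1)` — a
  non-zero `(d(𝒪ˣ,1), χ)`-EIGENclass `x₂ ∈ V_N`;
* Steps A–B of `GL2SphericalOfLFactorDegreeTwo` verbatim: an irreducible quotient character of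
  `V_N`, Frobenius reciprocity `π ↪ I(σ)`, `dim I(σ)_N ≤ 2`, `r_N` left exact; `x₁, x₂` are
  independent (`χ(u₀) ≠ 1`), so `dim V_N = dim I(σ)_N = 2` and `r_N(π) = r_N(I(σ))`;
* (Aux2, `levi_exponents_of_jacquet_eigenclasses`) the exponents of `I(σ)` are
  `{unramified, χ|_{𝒪ˣ}}` in one of the two orders;
* (Aux1, `exists_mem_fixedPoints_parabolicIndGL_fin_two_of_conductor_le_one`) `I(σ)` then has the
  explicit `K₁(𝔭)`-fixed vector supported on `B K₁(𝔭)`, resp. `B w₀ K₁(𝔭)`;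
* Step E verbatim (`exists_jacquetImage_lt`, `intertwiningMap_subrepresentation_parabolicIndGL_eq_zero`):
  `π ↪ I(σ)` is onto, so the vector lies in `π`.

References: [Casselman1973] Thm. 1; [JacquetLanglands1970] Prop. 3.5, Thm. 2.18;
[BernsteinZelevinskyASENS1977] Thm. 5.2; [BushnellHenniart2006] §9.11.
-/

set_option linter.dupNamespace false -- project-wide option (lakefile weak.linter.dupNamespace); `Summit.Langlands.Langlands` is the mandated namespace

noncomputable section

open scoped MatrixGroups Matrix NumberField Classical Polynomial
open Literature.NumberTheory.Automorphic Literature.NumberTheory.GaloisRepresentations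
  IsDedekindDomain NumberField Polynomial MeasureTheory
open Literature.NumberTheory.GaloisRepresentations.IsNonarchimedeanLocalField
open Field ValuativeRel
open Summit.Langlands Rat.HeightOneSpectrum

namespace Summit.Langlands.Langlands.Theorems.CorrespondentFingerprint

section Local

variable {F : Type*} [Field F] [ValuativeRel F] [TopologicalSpace F] [IsNonarchimedeanLocalField F]
  {W : Type*} [AddCommGroup W] [Module ℂ W]
  (σ : Representation ℂ (Π a, GL {i // (id : Fin 2 → Fin 2) i = a} F) W)
  {V : Type*} [AddCommGroup V] [Module ℂ V] {π : Representation ℂ (GL (Fin 2) F) V}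

set_option maxHeartbeats 1600000 in
/-- **Step E of `GL2SphericalOfLFactorDegreeTwo`, isolated**: an embedding `π ↪ I(σ)` of a
representation of `GL₂(F)` into a principal series with scalar datum `σ` which is onto on Jacquet
modules is onto — otherwise a proper Jacquet functor separates the image from `I(σ)`
(`exists_jacquetImage_lt`: `I(σ)` has no supercuspidal subquotient,
`intertwiningMap_subrepresentation_parabolicIndGL_eq_zero`), but the only proper standard parabolic
of `GL₂` is `B` and `r_N(π) = r_N(I(σ))`. [cite: BernsteinZelevinskyASENS1977, Thm. 5.2, §2] -/
theorem surjective_of_jacquetGLMap_surjective (hscalar : ∀ t, ∃ c : ℂ, ∀ w : W, σ t w = c • w)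
    (f : π.IntertwiningMap (Representation.parabolicIndGL F (id : Fin 2 → Fin 2) σ))
    (hsurjJ : Function.Surjective (jacquetGLMap F (id : Fin 2 → Fin 2) f).toLinearMap) :
    Function.Surjective f := by
  have hIs : (Representation.parabolicIndGL F (id : Fin 2 → Fin 2) σ).IsSmooth :=
    Representation.isSmooth_smoothInd _ _
  by_contra hns
  have hlt : f.range < ⊤ := by
    refine lt_top_iff_ne_top.2 fun htop => hns ?_
    have h1 : LinearMap.range f.toLinearMap = ⊤ := by
      have h2 := congrArg Subrepresentation.toSubmodule htop
      rwa [Representation.IntertwiningMap.range_toSubmodule] at h2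
    exact LinearMap.range_eq_top.1 h1
  have hcp : IsProperBlocks (id : Fin 2 → Fin 2) := ⟨Function.surjective_id, inferInstance⟩
  have hσZ : ∀ u : Fˣ, ∃ cu : ℂ, ∀ w, σ (leviProjection F (id : Fin 2 → Fin 2)
      ⟨_, scalar_mem_standardParabolicGL (id : Fin 2 → Fin 2) u⟩) w = cu • w := fun u => hscalar _
  obtain ⟨r, c, hcp', hcm, hlt'⟩ := exists_jacquetImage_lt hIs
    (fun N₀' W' _ _ τ' _ hτa hτc q =>
      intertwiningMap_subrepresentation_parabolicIndGL_eq_zero monotone_id hcp hσZ hτa hτc N₀' q) hlt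
  refine isProperBlocks_fin_two_elim
    (P := fun r (c : Fin 2 → Fin r) => ¬ jacquetImage c (Representation.parabolicIndGL F (id : Fin 2 → Fin 2) σ) f.range <
      jacquetImage c (Representation.parabolicIndGL F (id : Fin 2 → Fin 2) σ) ⊤) ?_ c hcp' hcm hlt'
  intro hlt''
  have hall : ∀ y, y ∈ jacquetImage (id : Fin 2 → Fin 2) (Representation.parabolicIndGL F (id : Fin 2 → Fin 2) σ) f.range := by
    refine hsurjJ.forall.2 fun x => ?_
    refine (Representation.Coinvariants.mk_surjective _ x).elim fun v hv => ?_
    rw [← hv]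
    exact (mem_jacquetImage_iff _ _ _ _).2
      ⟨f v, (Representation.IntertwiningMap.mem_range _ _ f _).2 ⟨v, rfl⟩, (jacquetGLMap_mk f v).symm⟩
  exact lt_irrefl _ (lt_of_lt_of_le hlt'' fun y _ => hall y)

set_option maxHeartbeats 1600000 in
/-- **The new vector of `I(σ)` from two eigenclasses of `π ↪ I(σ)`.**  Let `σ` be a smooth scalar
datum on a line `W`, `f : π ↪ I(σ)` an injective intertwining map from a representation `π` with
finite-dimensional Jacquet module `V_N`, and `x₁, x₂ ∈ V_N` non-zero classes with `d(u,1) x₁ = x₁`,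
`d(u,1) x₂ = χ(u) x₂` for all units `u`, where `χ` is trivial on `1 + 𝔭` and `χ(u₀) ≠ 1` for a unit
`u₀`.  Then `r_N(f)` is onto (`x₁, x₂` are independent and `dim I(σ)_N ≤ 2`,
`finiteDimensional_coinvariants_parabolicIndGL_fin_two`, `jacquetGLMap_injective`), the exponents
of `I(σ)` are `{1, χ}` on `𝒪ˣ` in one of the two orders (`levi_exponents_of_jacquet_eigenclasses`),
and `I(σ)` has a non-zero `K₁(𝔭)`-fixed vector
(`exists_mem_fixedPoints_parabolicIndGL_fin_two_of_conductor_le_one`).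
[cite: Casselman1973, Thm. 1] [cite: JacquetLanglands1970, Prop. 3.5] -/
theorem jacquetGLMap_surjective_and_exists_mem_fixedPoints [FiniteDimensional ℂ W] [Nontrivial W]
    (hσs : σ.IsSmooth) (hscalar : ∀ t, ∃ c : ℂ, ∀ w : W, σ t w = c • w)
    (hW1 : Module.finrank ℂ W = 1)
    [FiniteDimensional ℂ (Representation.restrictUnipotentGL F (id : Fin 2 → Fin 2) π).Coinvariants]
    (f : π.IntertwiningMap (Representation.parabolicIndGL F (id : Fin 2 → Fin 2) σ))
    (hf : Function.Injective f)
    (χ : Fˣ →* ℂˣ) (hχ1 : ∀ u : Fˣ, valuation F ((u : F) - 1) < 1 → χ u = 1)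
    {u₀ : Fˣ} (hu₀ : valuation F (u₀ : F) = 1) (hχu₀ : χ u₀ ≠ 1)
    {x₁ x₂ : (Representation.restrictUnipotentGL F (id : Fin 2 → Fin 2) π).Coinvariants}
    (hx₁0 : x₁ ≠ 0)
    (hx₁ : ∀ u : Fˣ, valuation F (u : F) = 1 → Representation.jacquetGL F (id : Fin 2 → Fin 2) π
      (leviProjection F (id : Fin 2 → Fin 2) ⟨diagGL2 u 1, diagGL2_mem_standardParabolicGL_fin_two u 1⟩) x₁ = x₁)
    (hx₂0 : x₂ ≠ 0)
    (hx₂ : ∀ u : Fˣ, valuation F (u : F) = 1 → Representation.jacquetGL F (id : Fin 2 → Fin 2) π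
      (leviProjection F (id : Fin 2 → Fin 2) ⟨diagGL2 u 1, diagGL2_mem_standardParabolicGL_fin_two u 1⟩) x₂ =
        ((χ u : ℂˣ) : ℂ) • x₂)
    (K : Subgroup (GL (Fin 2) F)) (hKo : IsOpen (K : Set (GL (Fin 2) F)))
    (hK : ∀ g : GL (Fin 2) F, g ∈ K ↔ g ∈ glInt 2 F ∧
      valuation F ((g : Matrix (Fin 2) (Fin 2) F) 1 0) < 1 ∧
        valuation F ((g : Matrix (Fin 2) (Fin 2) F) 1 1 - 1) < 1) :
    Function.Surjective (jacquetGLMap F (id : Fin 2 → Fin 2) f).toLinearMap ∧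
    ∃ f₀ : Representation.SmoothInd (standardParabolicGL F (id : Fin 2 → Fin 2))
        (Representation.twist (MonoidHom.comp σ (leviProjection F (id : Fin 2 → Fin 2)))
          (rootDeltaChar (standardParabolicGL F (id : Fin 2 → Fin 2)))),
      f₀ ≠ 0 ∧ f₀ ∈ (Representation.parabolicIndGL F (id : Fin 2 → Fin 2) σ).fixedPoints K := by
  -- Step B: `dim I(σ)_N ≤ 2`, `r_N(f)` injective
  obtain ⟨hJfd, hJle⟩ := finiteDimensional_coinvariants_parabolicIndGL_fin_two σ hσs
  have hJle2 : Module.finrank ℂ (Representation.restrictUnipotentGL F (id : Fin 2 → Fin 2)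
      (Representation.parabolicIndGL F (id : Fin 2 → Fin 2) σ)).Coinvariants ≤ 2 :=
    hJle.trans (by rw [hW1])
  clear hJle
  haveI := hJfd
  have hIs : (Representation.parabolicIndGL F (id : Fin 2 → Fin 2) σ).IsSmooth :=
    Representation.isSmooth_smoothInd _ _
  have hinj : Function.Injective (jacquetGLMap F (id : Fin 2 → Fin 2) f).toLinearMap :=
    jacquetGLMap_injective monotone_id hIs f hf
  have hVle := LinearMap.finrank_le_finrank_of_injective hinj
  -- `dim V_N = 2`: `x₁, x₂` are eigenvectors of `d(u₀, 1)` for the distinct eigenvalues `1, χ(u₀)`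
  have hli : LinearIndependent ℂ ![x₁, x₂] := by
    refine LinearIndependent.pair_iff.2 fun s t hst => ?_
    have e := congrArg (Representation.jacquetGL F (id : Fin 2 → Fin 2) π
      (leviProjection F (id : Fin 2 → Fin 2) ⟨diagGL2 u₀ 1, diagGL2_mem_standardParabolicGL_fin_two u₀ 1⟩)) hst
    rw [map_add, map_smul, map_smul, hx₁ u₀ hu₀, hx₂ u₀ hu₀, map_zero, smul_smul] at e
    have e2 : (t * (((χ u₀ : ℂˣ) : ℂ) - 1)) • x₂ = 0 := by
      have e3 : (s • x₁ + (t * ((χ u₀ : ℂˣ) : ℂ)) • x₂) - (s • x₁ + t • x₂) = 0 := by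
        rw [e, hst, sub_zero]
      rwa [add_sub_add_left_eq_sub, ← sub_smul, ← mul_sub_one] at e3
    rcases smul_eq_zero.1 e2 with h | h
    · rcases mul_eq_zero.1 h with ht | h'
      · subst ht
        rw [zero_smul, add_zero] at hst
        exact ⟨(smul_eq_zero.1 hst).resolve_right hx₁0, rfl⟩
      · exact absurd (Units.val_eq_one.1 (sub_eq_zero.1 h')) hχu₀
    · exact absurd h hx₂0
  have h2le : 2 ≤ Module.finrank ℂ (Representation.restrictUnipotentGL F (id : Fin 2 → Fin 2) π).Coinvariants := by
    simpa using hli.fintype_card_le_finrank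
  have hVN2 : Module.finrank ℂ (Representation.restrictUnipotentGL F (id : Fin 2 → Fin 2) π).Coinvariants = 2 :=
    le_antisymm (hVle.trans hJle2) h2le
  have hJN2 : Module.finrank ℂ (Representation.restrictUnipotentGL F (id : Fin 2 → Fin 2)
      (Representation.parabolicIndGL F (id : Fin 2 → Fin 2) σ)).Coinvariants = 2 :=
    le_antisymm hJle2 (h2le.trans hVle)
  have hsurjJ : Function.Surjective (jacquetGLMap F (id : Fin 2 → Fin 2) f).toLinearMap :=
    (LinearMap.injective_iff_surjective_of_finrank_eq_finrank
      (f := (jacquetGLMap F (id : Fin 2 → Fin 2) f).toLinearMap) (hVN2.trans hJN2.symm)).1 hinj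
  refine ⟨hsurjJ, ?_⟩
  -- Step D': the exponents of `I(σ)` from the images `y₁, y₂` of `x₁, x₂`
  have hy₁ : ∀ u : Fˣ, valuation F (u : F) = 1 →
      Representation.jacquetGL F (id : Fin 2 → Fin 2) (Representation.parabolicIndGL F (id : Fin 2 → Fin 2) σ)
        (leviProjection F (id : Fin 2 → Fin 2) ⟨diagGL2 u 1, diagGL2_mem_standardParabolicGL_fin_two u 1⟩)
        (jacquetGLMap F (id : Fin 2 → Fin 2) f x₁) = jacquetGLMap F (id : Fin 2 → Fin 2) f x₁ := by
    intro u hu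
    have h1 := congrArg (jacquetGLMap F (id : Fin 2 → Fin 2) f) (hx₁ u hu)
    have h2 := (jacquetGLMap F (id : Fin 2 → Fin 2) f).isIntertwining _ _
      (leviProjection F (id : Fin 2 → Fin 2) ⟨diagGL2 u 1, diagGL2_mem_standardParabolicGL_fin_two u 1⟩) x₁
    exact h2.symm.trans h1
  have hy₂ : ∀ u : Fˣ, valuation F (u : F) = 1 →
      Representation.jacquetGL F (id : Fin 2 → Fin 2) (Representation.parabolicIndGL F (id : Fin 2 → Fin 2) σ)
        (leviProjection F (id : Fin 2 → Fin 2) ⟨diagGL2 u 1, diagGL2_mem_standardParabolicGL_fin_two u 1⟩)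
        (jacquetGLMap F (id : Fin 2 → Fin 2) f x₂) =
        ((χ u : ℂˣ) : ℂ) • jacquetGLMap F (id : Fin 2 → Fin 2) f x₂ := by
    intro u hu
    have h1 := congrArg (jacquetGLMap F (id : Fin 2 → Fin 2) f) (hx₂ u hu)
    rw [map_smul] at h1
    have h2 := (jacquetGLMap F (id : Fin 2 → Fin 2) f).isIntertwining _ _
      (leviProjection F (id : Fin 2 → Fin 2) ⟨diagGL2 u 1, diagGL2_mem_standardParabolicGL_fin_two u 1⟩) x₂
    exact h2.symm.trans h1
  have hy₁0 : jacquetGLMap F (id : Fin 2 → Fin 2) f x₁ ≠ 0 := fun h =>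
    hx₁0 (hinj (h.trans (map_zero _).symm))
  have hy₂0 : jacquetGLMap F (id : Fin 2 → Fin 2) f x₂ ≠ 0 := fun h =>
    hx₂0 (hinj (h.trans (map_zero _).symm))
  have hexp := levi_exponents_of_jacquet_eigenclasses σ hσs hscalar hW1 χ hu₀ hχu₀ hy₁0 hy₁ hy₂0 hy₂
  -- the `K₁(𝔭)`-vector of `I(σ)`
  obtain ⟨w₀, hw₀⟩ := exists_ne (0 : W)
  exact exists_mem_fixedPoints_parabolicIndGL_fin_two_of_conductor_le_one σ K hKo hK χ hχ1 hw₀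
    (hexp.imp (fun h u hu => h u hu w₀) (fun h u hu => h u hu w₀))

end Local

set_option maxHeartbeats 1600000 in
/-- **(C3) `stub_local1951_reptheory` — conductor-one level vector from two `L`-degrees** (card
`twisted-l-degree-conductor-one`).  `π_v` irreducible smooth `ψ`-generic on `GL₂(F)`,
`χ : Fˣ → ℂˣ` trivial on `U¹` and non-trivial on `𝒪ˣ`; if for every invariant Radon full-support
`ν` the JPSS polynomials of `π_v × 1` and of `π_v × χ⁻¹` have degree `≥ 1`, then `π_v` has a
non-zero vector fixed by `K₁(𝔭) = {k ∈ GL₂(𝒪) : |k₂₁| < 1, |k₂₂ - 1| < 1}`.  Route (classification-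
free, extending `GL2SphericalOfLFactorDegreeTwo`): the pole bound `natDegree_le_finrank_of_hasRSLFactor`
gives a `d(𝒪ˣ,1)`-fixed class and (`hasRSLFactor_glOneRep_iff_twist`) a `(d(𝒪ˣ,1), χ)`-eigen class in
`V_N`, so `dim V_N = 2 = dim I(σ)_N`, `π_v = I(χ₁, χ₂)` with `{χ₁, χ₂} = {unramified, conductor one}`,
and the explicit `K₁(𝔭)`-vector of `I(χ₁, χ₂)` supported on `B K₁(𝔭)` / `B w K₁(𝔭)`.
[cite: JacquetLanglands1970, Prop. 3.5, Thm. 2.18] [cite: Casselman1973, Thm. 1] -/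
theorem stub_local1951_reptheory : ∀ (F : Type) [Field F] [ValuativeRel F] [TopologicalSpace F] [IsNonarchimedeanLocalField F] [CharZero F] (πv : SmoothIrrep (GL (Fin 2) F)) (ψ : AddChar F Circle), ψ.IsContinuousNontrivial → IsGeneric πv.ρ ψ → ∀ (χ : Fˣ →* ℂˣ), (∀ x ∈ unitFiltration F 1, χ x = 1) → (∃ x ∈ unitFiltration F 0, χ x ≠ 1) → (∀ [MeasurableSpace (GL (Fin 1) F ⧸ upperUnitriangular (Fin 1) F)] [BorelSpace (GL (Fin 1) F ⧸ upperUnitriangular (Fin 1) F)] (ν : Measure (GL (Fin 1) F ⧸ upperUnitriangular (Fin 1) F)) [SMulInvariantMeasure (GL (Fin 1) F) (GL (Fin 1) F ⧸ upperUnitriangular (Fin 1) F) ν] [IsFiniteMeasureOnCompacts ν] [ν.IsOpenPosMeasure], ∃ P : ℂ[X], HasRSLFactor Nat.one_lt_two πv.ρ (Representation.trivial ℂ (GL (Fin 1) F) ℂ) ψ ν P ∧ 1 ≤ P.natDegree) → (∀ [MeasurableSpace (GL (Fin 1) F ⧸ upperUnitriangular (Fin 1) F)] [BorelSpace (GL (Fin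 1) F ⧸ upperUnitriangular (Fin 1) F)] (ν : Measure (GL (Fin 1) F ⧸ upperUnitriangular (Fin 1) F)) [SMulInvariantMeasure (GL (Fin 1) F) (GL (Fin 1) F ⧸ upperUnitriangular (Fin 1) F) ν] [IsFiniteMeasureOnCompacts ν] [ν.IsOpenPosMeasure], ∃ P : ℂ[X], HasRSLFactor Nat.one_lt_two πv.ρ (glOneRep χ⁻¹) ψ ν P ∧ 1 ≤ P.natDegree) → ∃ x : πv.V, x ≠ 0 ∧ ∀ k : GL (Fin 2) F, k ∈ glInt 2 F → normAbs F ((k : Matrix (Fin 2) (Fin 2) F) 1 0) < 1 → normAbs F ((k : Matrix (Fin 2) (Fin 2) F) 1 1 - 1) < 1 → πv.ρ k x = x := by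
  intro F _ _ _ _ _ πv ψ hψ _hgen χ hχ1 hχ0 hL1 hLχ
  classical
  haveI := πv.isIrreducible
  have hπ : πv.ρ.IsSmooth := πv.isSmooth
  letI : MeasurableSpace F := borel F
  haveI : BorelSpace F := ⟨rfl⟩
  letI : MeasurableSpace (GL (Fin 1) F ⧸ upperUnitriangular (Fin 1) F) := borel _
  haveI : BorelSpace (GL (Fin 1) F ⧸ upperUnitriangular (Fin 1) F) := ⟨rfl⟩
  obtain ⟨K, hKo, hK⟩ := exists_subgroup_kOneP (F := F)
  -- the character: conductor hypotheses in valuation form, smoothness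
  have hχ1' : ∀ u : Fˣ, valuation F ((u : F) - 1) < 1 → χ u = 1 := fun u hu =>
    hχ1 u ((mem_unitFiltration_iff_sub_one_mem le_rfl u).2
      (by rw [Nat.cast_one]; exact LocalFieldHaar.mem_primePowBall_one_iff.2 hu))
  obtain ⟨u₀, hu₀, hχu₀⟩ : ∃ u₀ : Fˣ, valuation F (u₀ : F) = 1 ∧ χ u₀ ≠ 1 := by
    obtain ⟨x, hx, hx'⟩ := hχ0
    exact ⟨x, normAbs_eq_one_iff_valuation_eq_one.1 hx.1, hx'⟩
  have hχo : IsOpen (χ.ker : Set Fˣ) :=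
    Subgroup.isOpen_of_mem_nhds _ (Filter.mem_of_superset (unitFiltration_mem_nhds_one 1)
      fun x hx => hχ1 x hx)
  -- `V_N` is finite-dimensional; the two eigenclasses `x₁` (fixed) and `x₂` (`χ`-eigen)
  haveI hVfd := (finiteDimensional_coinvariants_smoothIrrep_fin_two πv).1
  obtain ⟨x₁, hx₁0, hx₁⟩ := exists_ne_zero_jacquetGL_eq_self_of_hasRSLFactor πv.ρ hπ hψ
    (fun ν _ _ _ => hL1 ν)
  obtain ⟨x₂, hx₂0, hx₂⟩ := exists_ne_zero_jacquetGL_eq_smul_of_hasRSLFactor_glOneRep πv.ρ hπ hψ hχo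
    (fun ν _ _ _ => hLχ ν)
  haveI hVN : Nontrivial (Representation.restrictUnipotentGL F (id : Fin 2 → Fin 2) πv.ρ).Coinvariants :=
    nontrivial_of_ne x₁ 0 hx₁0
  -- Step A: an irreducible quotient `σ₀` of the `T`-module `V_N` (a character) and `π ↪ I(σ)`
  obtain ⟨N₀, hN₀⟩ := Representation.exists_isCoatom_subrepresentation_jacquetGL F (id : Fin 2 → Fin 2) πv.ρ hπ
  haveI hσ₀irr : N₀.quotientRep.IsIrreducible := Subrepresentation.isIrreducible_quotientRep hN₀
  have hσ₀s : N₀.quotientRep.IsSmooth :=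
    (Representation.IsSmooth.jacquetGL F (id : Fin 2 → Fin 2) hπ).quotientRep N₀
  have hq0 : N₀.mkQ ≠ 0 := by
    intro h
    apply hN₀.1
    refine eq_top_iff.2 fun x _ => (N₀.mkQ_eq_zero_iff x).1 ?_
    rw [h]
    rfl
  obtain ⟨σ, hσ_def⟩ : ∃ σ : Representation ℂ (Π a, GL {i // (id : Fin 2 → Fin 2) i = a} F)
      ((Representation.restrictUnipotentGL F (id : Fin 2 → Fin 2) πv.ρ).Coinvariants ⧸ N₀.toSubmodule),
      σ = N₀.quotientRep.twist ((rootDeltaChar (standardParabolicGL F (id : Fin 2 → Fin 2))).comp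
        (leviEmbeddingP F (id : Fin 2 → Fin 2)))⁻¹ := ⟨_, rfl⟩
  have hσs : σ.IsSmooth := by
    rw [hσ_def]
    exact Representation.IsSmooth.twist_rootDeltaChar_inv F (id : Fin 2 → Fin 2) hσ₀s
  have hsc₀ := exists_apply_eq_smul_of_isIrreducible_levi_fin_two N₀.quotientRep hσ₀s
  have hscalar : ∀ t, ∃ c : ℂ, ∀ w, σ t w = c • w := fun t => by
    obtain ⟨c, hc⟩ := hsc₀ t
    refine ⟨((((rootDeltaChar (standardParabolicGL F (id : Fin 2 → Fin 2))).comp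
      (leviEmbeddingP F (id : Fin 2 → Fin 2)))⁻¹ t : ℂˣ) : ℂ) * c, fun w => ?_⟩
    rw [hσ_def, Representation.twist_apply, hc, smul_smul]
  obtain ⟨hWfd, hW1⟩ := finrank_eq_one_of_isIrreducible_of_smul N₀.quotientRep hsc₀
  haveI := hWfd
  haveI hWnt := Representation.IsIrreducible.nontrivial N₀.quotientRep
  obtain ⟨f, hf⟩ : ∃ f : πv.ρ.IntertwiningMap (Representation.parabolicIndGL F (id : Fin 2 → Fin 2) σ),
      Function.Injective f := by
    rw [hσ_def]
    exact Representation.exists_injective_intertwiningMap_parabolicIndGL F (id : Fin 2 → Fin 2)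
      πv.ρ hπ N₀.quotientRep N₀.mkQ hq0
  -- Steps B, D' and the `K₁(𝔭)`-vector `f₀` of `I(σ)`; Step E: `π ↪ I(σ)` is onto
  obtain ⟨hsurjJ, f₀, hf₀0, hf₀K⟩ := jacquetGLMap_surjective_and_exists_mem_fixedPoints σ hσs hscalar
    hW1 f hf χ hχ1' hu₀ hχu₀ hx₁0 hx₁ hx₂0 hx₂ K hKo hK
  have hsurj : Function.Surjective f := surjective_of_jacquetGLMap_surjective σ hscalar f hsurjJ
  -- conclusion: `f₀ = f v` with `v ≠ 0` fixed by `K₁(𝔭)`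
  refine (hsurj f₀).elim fun v hv => ⟨v, fun h0 => hf₀0 ?_, fun k hk hk10 hk11 => ?_⟩
  · rw [← hv, h0]
    exact map_zero f
  · apply hf
    have hkK : k ∈ K := (hK k).2 ⟨hk, normAbs_lt_one_iff.1 hk10, normAbs_lt_one_iff.1 hk11⟩
    have h1 := f.isIntertwining _ _ k v
    have h2 := ((Representation.parabolicIndGL F (id : Fin 2 → Fin 2) σ).mem_fixedPoints K f₀).1
      hf₀K k hkK
    rw [← hv] at h2
    exact h1.trans h2

end Summit.Langlands.Langlands.Theorems.CorrespondentFingerprint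

end
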